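import Summits.KontsevichZagierPeriods.KontsevichZagierPeriods.Theorems.HurwitzMicroSectorsNormalFormPrincipleLevelKLayer

/-!
# `NormalFormPrinciple` (stmt-KontsevichZagierPeriods-3869), line `SketchIdeator1` — leaf `stub_boxRigidity`:
# WEIGHT TWO, LEVEL `K`, POLYNOMIAL NUMERATORS OFF THE DIAGONAL (rule 1 over `…LevelKLayer`)

Boxes `[(0,1)², P(x,y)/(1 − x^K y^K)]` with `P ∈ ℚ[x,y]` having NO DIAGONAL MONOMIAL (`s₀ ≠ s₁` for every
`s` in the support; the diagonal part `Q(xy)/(1 − (xy)^K)` is the route's sector `(2,K)`): by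
integrand additivity (rule 1) such a box is congruent modulo relations to the sum of its monomial
boxes, each of which `…LevelKLayer` sends to a rational representation of dimension one (rules 2, 3;
`LevelK.offdiag_sub_dimOne`). Hence these boxes join the Baker layer: two of them with equal values
are KZ-equivalent, and so is such a box against any rational representation of dimension `≤ 1`
(`offdiagPoly_equivalent_dimLeOne_of_value_eq`), unconditionally (seat c4's kernel theorem).
References: M. Kontsevich, D. Zagier, *Periods* (2001), §1.2. No new definitions.
-/

noncomputable section

open MeasureTheory Set
open Literature.NumberTheory.Transcendental Literature.NumberTheory.Transcendental.KZ
open Literature.ModelTheory.ExponentialFields (IsSemialgebraic)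

namespace Summit.KontsevichZagierPeriods.HurwitzMicroSectors.NormalFormPrinciple.PiBox.LevelK

open Summit.KontsevichZagierPeriods.HurwitzMicroSectors.NormalFormPrinciple.PiBox.Dlog
  (mem_relations_of_eval_eq_zero_of_dim_le_one)

/-- **Existence of the level-`K` representation** `[(0,1)², (Σ_{s∈S} c_s x^{s₀}y^{s₁})/(1 − x^K y^K)]`
for rational coefficients. [cite: KontsevichZagier2001, §1.1] -/
theorem exists_levelKRep (K : ℕ) (hK : 0 < K) (S : Finset (Fin 2 →₀ ℕ)) (coef : (Fin 2 →₀ ℕ) → ℚ) :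
    ∃ N : IntegralRep 2, N.domain = {x | ∀ i, x i ∈ Set.Ioo (0:ℝ) 1} ∧
      N.integrand = fun x => (∑ s ∈ S, (coef s : ℝ) * (x 0 ^ (s 0) * x 1 ^ (s 1))) /
        (1 - x 0 ^ K * x 1 ^ K) := by
  classical
  induction S using Finset.induction_on with
  | empty =>
    obtain ⟨N, hNd, hNi⟩ := (levelK_exists_reps K hK 0 isAlgebraic_zero).1 0 0
    refine ⟨N, hNd, ?_⟩
    rw [hNi]
    funext x
    simp
  | insert s S hs ih =>
    obtain ⟨N₁, hN₁d, hN₁i⟩ := ih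
    have hc : IsAlgebraic ℚ ((coef s : ℚ) : ℝ) := isAlgebraic_algebraMap _
    obtain ⟨N₂, hN₂d, hN₂i⟩ := (levelK_exists_reps K hK _ hc).1 (s 0) (s 1)
    refine ⟨⟨N₁.domain, fun x => (∑ t ∈ insert s S, (coef t : ℝ) * (x 0 ^ (t 0) * x 1 ^ (t 1))) /
        (1 - x 0 ^ K * x 1 ^ K), N₁.isSemialgebraic_domain, ?_, ?_⟩, hN₁d, rfl⟩
    · refine (IsSemialgebraicFunOn.add_holds (hN₂d.trans hN₁d.symm ▸ N₂.isSemialgebraicFunOn_integrand)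
        N₁.isSemialgebraicFunOn_integrand).congr fun x _ => ?_
      rw [hN₁i, hN₂i]
      simp only [Pi.add_apply, Finset.sum_insert hs]
      ring
    · have h := ((hN₂d.trans hN₁d.symm) ▸ N₂.integrableOn).add N₁.integrableOn
      refine h.congr_fun (fun x _ => ?_) (IntegralRep.measurableSet_domain_holds N₁)
      rw [hN₁i, hN₂i]
      simp only [Pi.add_apply, Finset.sum_insert hs]
      ring

/-- **Off-diagonal polynomial numerators**: `[(0,1)², (Σ_{s∈S} c_s x^s)/(1 − x^K y^K)]` with `s₀ ≠ s₁`
on `S` is congruent modulo relations to an element of the subgroup generated by the rational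
representations of dimension `≤ 1`. [cite: KontsevichZagier2001, §1.2] -/
theorem offdiagPoly_exists_mem_dimLeOneClosure (K : ℕ) (hK : 0 < K) (coef : (Fin 2 →₀ ℕ) → ℚ) :
    ∀ (S : Finset (Fin 2 →₀ ℕ)), (∀ s ∈ S, s 0 ≠ s 1) → ∀ (N : IntegralRep 2),
    N.domain = {x | ∀ i, x i ∈ Set.Ioo (0:ℝ) 1} →
    EqOn N.integrand (fun x => (∑ s ∈ S, (coef s : ℝ) * (x 0 ^ (s 0) * x 1 ^ (s 1))) /
      (1 - x 0 ^ K * x 1 ^ K)) N.domain →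
    ∃ x' ∈ AddSubgroup.closure
        {y : FormalRep | ∃ (m : ℕ) (M : IntegralRep m), m ≤ 1 ∧ M.IsRational ∧ y = of M},
      of N - x' ∈ relations := by
  classical
  intro S
  induction S using Finset.induction_on with
  | empty =>
    intro _ N hNd hNi
    have hN : of N ∈ relations := of_mem_relations_of_eqOn_zero N fun x hx => by rw [hNi hx]; simp
    exact ⟨0, AddSubgroup.zero_mem _, by simpa using hN⟩
  | insert s S hs ih =>
    intro hoff N hNd hNi
    have hoffS : ∀ t ∈ S, t 0 ≠ t 1 := fun t ht => hoff t (Finset.mem_insert_of_mem ht)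
    obtain ⟨N₁, hN₁d, hN₁i⟩ := exists_levelKRep K hK S coef
    have hc : IsAlgebraic ℚ ((coef s : ℚ) : ℝ) := isAlgebraic_algebraMap _
    obtain ⟨N₂, hN₂d, hN₂i⟩ := (levelK_exists_reps K hK _ hc).1 (s 0) (s 1)
    obtain ⟨x₁, hx₁, e₁⟩ := ih hoffS N₁ hN₁d (hN₁i ▸ fun _ _ => rfl)
    obtain ⟨M, hM, e₂⟩ := offdiag_sub_dimOne K hK (s 0) (s 1) (hoff s (Finset.mem_insert_self s S))
      (coef s) N₂ hN₂d (hN₂i ▸ fun _ _ => rfl)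
    have eN : of N - of N₂ - of N₁ ∈ relations := by
      refine integrandAddRel_subset_relations ⟨2, N, N₂, N₁, hN₂d.trans hNd.symm, hN₁d.trans hNd.symm,
        fun x hx => ?_, rfl⟩
      rw [Pi.add_apply, hNi hx, hN₁i, hN₂i]
      simp only [Finset.sum_insert hs]
      ring
    refine ⟨of M + x₁, AddSubgroup.add_mem _ (AddSubgroup.subset_closure ⟨1, M, le_rfl, hM, rfl⟩) hx₁, ?_⟩
    have e : of N - (of M + x₁) = (of N - of N₂ - of N₁) + (of N₂ - of M) + (of N₁ - x₁) := by abel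
    rw [e]
    exact relations.add_mem (relations.add_mem eN e₂) e₁

/-- **An off-diagonal level-`K` polynomial box against ANY rational representation of dimension `≤ 1`**
— equal values imply KZ-equivalence, unconditionally (e.g. `∫∫ (x − y²) dxdy/(1 − x³y³)` against an
interval integral of a rational function). [cite: KontsevichZagier2001, §1.2 Conjecture 1] -/
theorem offdiagPoly_equivalent_dimLeOne_of_value_eq {m : ℕ} (hm : m ≤ 1) (K : ℕ) (hK : 0 < K)
    (S : Finset (Fin 2 →₀ ℕ)) (coef : (Fin 2 →₀ ℕ) → ℚ) (hoff : ∀ s ∈ S, s 0 ≠ s 1)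
    (N : IntegralRep 2) (M : IntegralRep m) (hM : M.IsRational)
    (hNd : N.domain = {x | ∀ i, x i ∈ Set.Ioo (0:ℝ) 1})
    (hNi : EqOn N.integrand (fun x => (∑ s ∈ S, (coef s : ℝ) * (x 0 ^ (s 0) * x 1 ^ (s 1))) /
      (1 - x 0 ^ K * x 1 ^ K)) N.domain)
    (hv : N.value = M.value) : Equivalent N M := by
  obtain ⟨x', hx', e⟩ := offdiagPoly_exists_mem_dimLeOneClosure K hK coef S hoff N hNd hNi
  -- `x := x' − of M` lies in the dimension-≤1 subgroup and has value 0
  have hx : x' - of M ∈ AddSubgroup.closure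
      {y : FormalRep | ∃ (m : ℕ) (M : IntegralRep m), m ≤ 1 ∧ M.IsRational ∧ y = of M} :=
    AddSubgroup.sub_mem _ hx' (AddSubgroup.subset_closure ⟨m, M, hm, hM, rfl⟩)
  have h0 : eval (x' - of M) = 0 := by
    have h := relations_le_ker_eval_holds e
    rw [AddMonoidHom.mem_ker, map_sub, eval_of] at h
    rw [map_sub, eval_of, ← hv]
    linarith
  have hr := mem_relations_of_eval_eq_zero_of_dim_le_one hx h0
  show of N - of M ∈ relations
  have e' : of N - of M = (of N - x') + (x' - of M) := by abel
  rw [e']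
  exact relations.add_mem e hr

/-- **Two off-diagonal level-`K` polynomial boxes with equal values are KZ-equivalent**
(unconditionally). [cite: KontsevichZagier2001, §1.2 Conjecture 1] -/
theorem offdiagPoly_equivalent_of_value_eq (K K' : ℕ) (hK : 0 < K) (hK' : 0 < K')
    (S S' : Finset (Fin 2 →₀ ℕ)) (coef coef' : (Fin 2 →₀ ℕ) → ℚ) (hoff : ∀ s ∈ S, s 0 ≠ s 1)
    (hoff' : ∀ s ∈ S', s 0 ≠ s 1) (N N' : IntegralRep 2)
    (hNd : N.domain = {x | ∀ i, x i ∈ Set.Ioo (0:ℝ) 1})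
    (hNi : EqOn N.integrand (fun x => (∑ s ∈ S, (coef s : ℝ) * (x 0 ^ (s 0) * x 1 ^ (s 1))) /
      (1 - x 0 ^ K * x 1 ^ K)) N.domain)
    (hN'd : N'.domain = {x | ∀ i, x i ∈ Set.Ioo (0:ℝ) 1})
    (hN'i : EqOn N'.integrand (fun x => (∑ s ∈ S', (coef' s : ℝ) * (x 0 ^ (s 0) * x 1 ^ (s 1))) /
      (1 - x 0 ^ K' * x 1 ^ K')) N'.domain)
    (hv : N.value = N'.value) : Equivalent N N' := by
  obtain ⟨x₁, hx₁, e₁⟩ := offdiagPoly_exists_mem_dimLeOneClosure K hK coef S hoff N hNd hNi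
  obtain ⟨x₂, hx₂, e₂⟩ := offdiagPoly_exists_mem_dimLeOneClosure K' hK' coef' S' hoff' N' hN'd hN'i
  have hx : x₁ - x₂ ∈ AddSubgroup.closure
      {y : FormalRep | ∃ (m : ℕ) (M : IntegralRep m), m ≤ 1 ∧ M.IsRational ∧ y = of M} :=
    AddSubgroup.sub_mem _ hx₁ hx₂
  have h0 : eval (x₁ - x₂) = 0 := by
    have h₁ := relations_le_ker_eval_holds e₁
    have h₂ := relations_le_ker_eval_holds e₂
    rw [AddMonoidHom.mem_ker, map_sub, eval_of] at h₁ h₂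
    rw [map_sub]
    have hv' : eval (of N) = eval (of N') := by rw [eval_of, eval_of, hv]
    linarith
  have hr := mem_relations_of_eval_eq_zero_of_dim_le_one hx h0
  show of N - of N' ∈ relations
  have e' : of N - of N' = (of N - x₁) + (x₁ - x₂) - (of N' - x₂) := by abel
  rw [e']
  exact relations.sub_mem (relations.add_mem e₁ hr) e₂

end Summit.KontsevichZagierPeriods.HurwitzMicroSectors.NormalFormPrinciple.PiBox.LevelK
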